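import Literature.MathematicalPhysics.QuantumFieldTheory.Balaban1983to89.B5Eq199QGQTorus
import Literature.MathematicalPhysics.QuantumFieldTheory.Balaban1983to89.B5QGQ199Rate

/-!
# `Balaban1983to89.B5Ineq1101QGQTorus` — T. Bałaban, *Propagators and renormalization transformations for lattice gauge
theories. I*, Commun. Math. Phys. **95** (1984) 17–40 [Balaban1984PropagatorsI], p. 34 after (1.101): «from which it follows that it
is bounded from below and above by positive constants dependent on d only (for a = 1). **The same property holds for QGQ*.**» — PROVED
as a UNIFORM two-sided LÖWNER bound on every torus for the concrete operators `Q = Q_k` (1.18), `G = Δ_a⁻¹` (1.69)–(1.71):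
`γ_E·I ≤ QGQ* ≤ a⁻¹·I`, `γ_E = γ₀/(4d + a)`, `γ₀ = (4/π²)^{d+2}`, INDEPENDENT of `n = L^k` and of the torus `T`.

statement-level skeleton of published theorems with citation tags; proofs where landed; nothing here is a claim about the Yang–Mills mass gap

PDF held: `paper:balaban1984-cmp95-propagators-rt-i` (journal page = PDF page + 16); p. 34 [PDF 18] read this session from the materialised
text `~/.lit/texts/paper-balaban1984-cmp95-propagators-rt-i/p0018.txt`.

CITATION HEADER (lean-in-tree rule) — WHAT IS REPRODUCED.  SKELETON row **B5.Eq1.101** ((1.99)–(1.101), fold owner r02) of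
`run/shared/lean/pub/lit-balaban/SKELETON.md`, the closing sentence for `QGQ*` AS AN OPERATOR STATEMENT ON THE TORUS.  State of the tree
before this file: (1.99) and the Löwner form of (1.100) `a⁻¹(φ − 1)φ⁻¹ ≤ QGQ* ≤ a⁻¹I` for the concrete torus operators
(`B5Eq199QGQTorus.eq199`/`ineq1100_lower`/`ineq1100_upper`, seat p37 gen 3); (1.101) and its two-sided bounds PER FIBRE `p′ ≠ 0`
(`B5QGQ199Rate.m101_eq`/`m101_bounds`, constant `γ₀/(4d + a)`); `QGQ*` positive definite QUALITATIVELY (`Beta.FluctuationProjection.QGQh_posDef`,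
whose docstring defers the quantitative bounds).  THIS FILE assembles them into the printed sentence: a lower bound of `QGQ*` by a positive
constant depending on `d` (and `a`) only, uniform in the averaging scale and in the volume — the input «(QGQ*)⁻¹ bounded» of (1.102)–(1.103)
and the hypothesis `M_lower` of [BalabanImbrieJaffe1985] (7.2.2) (`BIJ85Ineq722Torus.TorusHyps`).  Phase-2 seat **p09** gen 5 (unit
`lit-balaban-p09`, HOME `run/shared/lean/pub/lit-balaban/`, STATUS `lit-balaban-p09/STATUS.md`), 2026-08-21.  Kind «model-instance inequality».

THE PRINTED TEXT (verbatim, p. 34): «and can be bounded as follows a⁻¹(φ − 1)φ⁻¹ ≤ QGQ* ≤ a⁻¹I. (1.100) The operator a⁻¹(φ − 1)/φ has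
the momentum representation a⁻¹(φ_μ(p′) − 1)/φ_μ(p′) = … (1.101) from which it follows that it is bounded from below and above by positive
constants dependent on d only (for a = 1). The same property holds for QGQ*. The condition QA = B gives the equation − QGQ*ω = B,
−ω = (QGQ*)⁻¹B, (1.102)».

DICTIONARY (as in `B5Eq199QGQTorus`): unit lattice `T₁^{(k)} = Tor M`, fine lattice `T_η = Tor (fine n M)`, `n = L^k`; `Q = QvOp n M`,
`Q* = QvAdj n M` (`= n^d·Qᴴ`, the (1.21) adjoint), `G = (DeltaA n M a)⁻¹`, `φ = Phi176 n M a`, `φ⁻¹ = Phi176Inv n M a` (componentwise Fourier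
multiplier `φ_μ(p′)⁻¹`, `φ_μ = phi184`), `P₀ = P0M M` (projection onto the constant configurations).  `≤` = Löwner order of the
`ℓ²(T₁^{(k)}; ℂ^d)` forms (`Matrix.PosSemidef` of the difference); the unit-lattice scalar product (1.21) is the plain sum.

WHAT IS PROVED (kernel; theorems only — no `def`, no `def … : Prop`, nothing is a hypothesis of printed shape):
* §1 the componentwise Fourier multipliers `cMul` of `B5Phi162Torus` as ONE unitary conjugation `F_V^*·diag·F_V` (`cMul_eq_conj`), hence their
  algebra (`cMul_add/sub/smul/one`) and POSITIVITY FROM THE SYMBOL (`cMul_posSemidef`); the projection `P₀` IS the multiplier `1_{p′ = 0}`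
  (`P0M_eq_cMul`).
* §2 the lower model of (1.100): `(φ − 1)φ⁻¹ + P₀` is the multiplier `1 − φ_μ(p′)⁻¹ + 1_{p′=0}` (`lowerModel_eq_cMul`), and ITS SYMBOL IS BOUNDED
  BELOW: `γ₀/(4d + a) ≤ a⁻¹(1 − φ_μ(p′)⁻¹ + 1_{p′=0})` for EVERY `p′` (`symbol_lower`: at `p′ ≠ 0` this is (1.101) `m101_bounds`; at `p′ = 0`
  the constant mode contributes `a⁻¹ ≥ γ₀/(4d+a)`), whence `γ_E·I ≤ a⁻¹((φ − 1)φ⁻¹ + P₀)` (`lowerModel_sub_smul_posSemidef`); and the (1.101)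
  sentence for `a⁻¹(φ − 1)/φ` itself: `0 ≤ a⁻¹(φ − 1)φ⁻¹ ≤ a⁻¹I` on all of `ℓ²` and `γ_E‖ω‖² ≤ a⁻¹Re⟨ω,(φ − 1)φ⁻¹ω⟩` for `ω ⊥` constants
  (`phiModel_posSemidef`, `smul_one_sub_phiModel_posSemidef`, `re_form_phiModel_ge_of_orthConst`).
* §3 **«The same property holds for QGQ*»**: `QGQ* − γ_E·I ⪰ 0` (`QGQ_sub_smul_one_posSemidef`), by (1.99) in the form
  `QGQ* = a⁻¹(φ − 1)φ⁻¹ + a⁻¹P₀ + a⁻¹(∂₁*φ⁻¹)ᴴ(∂₁*φ⁻¹∂₁)⁻¹(∂₁*φ⁻¹)` (`B5Eq199QGQTorus.QGQ_sub_lower_eq`) = lower model + Gram term;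
  the two-sided statement with (1.100)'s upper half (`QGQ_twoSided`); the quadratic-form reading
  `γ_E·‖ω‖² ≤ Re⟨ω, QGQ*ω⟩ ≤ a⁻¹‖ω‖²` (`re_form_QGQ_ge`, `re_form_QGQ_bounds`); the `B5QGQ171Unit.covB` form (`covB_sub_smul_one_posSemidef`).
HONEST SCOPE.  `U = 1` (the paper's Sect. 1 setting), complex fields, every `d`, every `n ≥ 1`, every torus `Tor M`, every `a > 0`; the
constant `γ_E = γ₀/(4d + a)` with `γ₀ = T4GaugeActionRate.gam0 d = (4/π²)^{d+2}` is OURS (the tree's (1.101) constant) and not optimal —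
print says only «positive constants dependent on d only (for a = 1)».  NOT summit progress.
-/

open scoped BigOperators Matrix ComplexConjugate ComplexOrder
open Finset Complex

namespace Literature.MathematicalPhysics.QuantumFieldTheory.Balaban1983to89.B5Ineq1101QGQTorus

open B5Prop11Plancherel (Tor dft dftV dftV_apply star_dftV_mul sOf abs_sOf_le sOf_ne_zero chi_zero_left)
open B5Block118 (QvOp cT dft_apply')
open B5Action121 (GradOp comp)
open B5DeltaA169 (QvAdj DeltaA)
open B5Phi162Torus (cMul liftV OrthConst dft_comp_zero_of_orthConst)
open B5Phi176Torus (Phi176 Phi176Inv phi184 phi184_pos Phi176_mul_Phi176Inv GPhiEInv)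
open B5Hk160Torus (P0M P0M_mulVec B0 constV)
open B5Eq199QGQTorus (QGQ_sub_lower_eq GPhiEInv_posSemidef ineq1100_upper QGQ_isHermitian QGQ_eq_covB)
open B5QGQ199Rate (m101 m101_bounds)
open B5Bounds167Lattice (phi162 phi162_nonneg phiMu_eq_one_add)
open T4GaugeActionRate (gam0 gam0_pos gam0_le_one)
open B5QGQ171Unit (covB)

noncomputable section

variable {d : ℕ}

/-! ## §1  Componentwise Fourier multipliers as one unitary conjugation; positivity from the symbol; `P₀` -/

section CMul

variable (N : Fin d → ℕ) [hN : ∀ μ, NeZero (N μ)]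

omit hN in
/-- the componentwise lift `liftV` IS Mathlib's `blockDiagonal` (block index = the vector index). [folklore] -/
private theorem liftV_eq_blockDiagonal (L : Fin d → Matrix (Tor N) (Tor N) ℂ) : liftV N L = Matrix.blockDiagonal L := by
  ext ⟨x, μ⟩ ⟨y, ν⟩
  rw [Matrix.blockDiagonal_apply]
  rfl

/-- **a componentwise Fourier multiplier is ONE unitary conjugation** («has the momentum representation»): `cMul m = F_V^* · diag(m_μ(p′)) · F_V`
with the componentwise DFT `F_V = dftV` (unitary, `B5Prop11Plancherel.dftV_mem_unitaryGroup`). [cite: Balaban1984PropagatorsI, (1.101) p.34] -/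
theorem cMul_eq_conj (m : Fin d → Tor N → ℂ) :
    cMul N m = (dftV N)ᴴ * Matrix.diagonal (fun i : Tor N × Fin d => m i.2 i.1) * dftV N := by
  rw [cMul, liftV_eq_blockDiagonal, dftV, Matrix.blockDiagonal_conjTranspose, ← Matrix.blockDiagonal_diagonal,
    ← Matrix.blockDiagonal_mul, ← Matrix.blockDiagonal_mul]

/-- multipliers add: `cMul m + cMul m′ = cMul (m + m′)`. [folklore] -/
private theorem cMul_add (m m' : Fin d → Tor N → ℂ) : cMul N m + cMul N m' = cMul N (m + m') := by
  rw [cMul_eq_conj, cMul_eq_conj, cMul_eq_conj, ← Matrix.add_mul, ← Matrix.mul_add, Matrix.diagonal_add]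
  rfl

/-- multipliers subtract: `cMul m − cMul m′ = cMul (m − m′)`. [folklore] -/
private theorem cMul_sub (m m' : Fin d → Tor N → ℂ) : cMul N m - cMul N m' = cMul N (m - m') := by
  rw [cMul_eq_conj, cMul_eq_conj, cMul_eq_conj, ← Matrix.sub_mul, ← Matrix.mul_sub, Matrix.diagonal_sub]
  rfl

/-- scalars: `c • cMul m = cMul (c • m)`. [folklore] -/
private theorem cMul_smul (c : ℂ) (m : Fin d → Tor N → ℂ) : c • cMul N m = cMul N (c • m) := by
  rw [cMul_eq_conj, cMul_eq_conj, ← Matrix.smul_mul, ← Matrix.mul_smul]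
  congr 2
  ext i j
  simp only [Matrix.smul_apply, Matrix.diagonal_apply, Pi.smul_apply, smul_eq_mul, mul_ite, mul_zero]

/-- the unit symbol gives the identity: `cMul 1 = 1` (`F_V^*F_V = 1`). [folklore] -/
private theorem cMul_one : cMul N (fun _ _ => (1 : ℂ)) = 1 := by
  rw [cMul_eq_conj]
  calc (dftV N)ᴴ * (Matrix.diagonal fun _ : Tor N × Fin d => (1 : ℂ)) * dftV N
      = (dftV N)ᴴ * dftV N := by rw [Matrix.diagonal_one, Matrix.mul_one]
    _ = 1 := by rw [← Matrix.star_eq_conjTranspose, star_dftV_mul]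

omit hN in
/-- the diagonal of a non-negative symbol is `⪰ 0`. [folklore] -/
private theorem diag_posSemidef {m : Fin d → Tor N → ℂ} (hm : ∀ μ q, 0 ≤ m μ q) :
    (Matrix.diagonal fun i : Tor N × Fin d => m i.2 i.1).PosSemidef :=
  Matrix.PosSemidef.diagonal fun i => hm i.2 i.1

/-- `F_V^*·diag·F_V ⪰ 0` for a non-negative symbol. [folklore] -/
private theorem conj_posSemidef {m : Fin d → Tor N → ℂ} (hm : ∀ μ q, 0 ≤ m μ q) :
    ((dftV N)ᴴ * Matrix.diagonal (fun i : Tor N × Fin d => m i.2 i.1) * dftV N).PosSemidef :=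
  (diag_posSemidef N hm).conjTranspose_mul_mul_same (dftV N)

/-- **positivity from the symbol** (the mechanism of «from which it follows that it is bounded from below and above»): a componentwise
Fourier multiplier with non-negative symbol is `⪰ 0`. [cite: Balaban1984PropagatorsI, (1.101) p.34] -/
theorem cMul_posSemidef {m : Fin d → Tor N → ℂ} (hm : ∀ μ q, 0 ≤ m μ q) : (cMul N m).PosSemidef := by
  rw [cMul_eq_conj]
  exact conj_posSemidef N hm

/-- entries of the DFT at zero momentum: `F_{0,x} = |T|^{-1/2}`. [folklore] -/
private theorem dft_zero_row (x : Tor N) : dft N 0 x = (cT N : ℂ) := by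
  rw [dft_apply', chi_zero_left, map_one, mul_one]

/-- `|T|^{-1/2}·|T|^{-1/2} = |T|⁻¹`. [folklore] -/
private theorem cT_mul_cT : (cT N : ℂ) * (cT N : ℂ) = ((Fintype.card (Tor N) : ℂ))⁻¹ := by
  have hc : (0 : ℝ) ≤ (Fintype.card (Tor N) : ℝ) := Nat.cast_nonneg _
  rw [← Complex.ofReal_mul]
  unfold cT
  rw [← mul_inv, Real.mul_self_sqrt hc]
  push_cast
  rfl

/-- **the projection onto the constant configurations IS the zero-mode multiplier**: `P₀ = cMul 1_{p′ = 0}`. [cite: Balaban1984PropagatorsI, p.27 before (1.58)] -/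
theorem P0M_eq_cMul : P0M N = cMul N (fun _ q => if q = 0 then (1 : ℂ) else 0) := by
  ext ⟨x, μ⟩ ⟨y, ν⟩
  rw [cMul_eq_conj, Matrix.mul_apply]
  simp only [Matrix.mul_diagonal, Matrix.conjTranspose_apply]
  -- the sum over `k = (q, κ)` has the single non-zero term `k = (0, μ)` (and vanishes unless `μ = ν`)
  rw [Finset.sum_eq_single (((0 : Tor N), μ) : Tor N × Fin d)]
  · rw [dftV_apply, dftV_apply, if_pos rfl, if_pos rfl, dft_zero_row]
    show (if μ = ν then ((Fintype.card (Tor N) : ℂ))⁻¹ else 0) = _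
    by_cases h : μ = ν
    · subst h
      rw [if_pos rfl, if_pos rfl, mul_one, dft_zero_row, Complex.star_def, Complex.conj_ofReal, cT_mul_cT]
    · rw [if_neg h, if_neg h, mul_zero]
  · rintro ⟨q, κ⟩ - hk
    rw [dftV_apply, dftV_apply]
    by_cases hκ : κ = μ
    · subst hκ
      have hq : q ≠ 0 := fun h => hk (by rw [h])
      rw [if_neg hq, mul_zero, zero_mul]
    · rw [if_neg hκ, star_zero, zero_mul, zero_mul]
  · intro h
    exact absurd (Finset.mem_univ _) h

end CMul

/-! ## §2  The lower model of (1.100): `(φ − 1)φ⁻¹ + P₀` as a multiplier, and its symbol bounded below uniformly -/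

section Model

variable (n : ℕ) [NeZero n] (M : Fin d → ℕ) [hM : ∀ μ, NeZero (M μ)] (a : ℝ)

/-- `(φ − 1)φ⁻¹ = I − φ⁻¹` (`φφ⁻¹ = I`). [cite: Balaban1984PropagatorsI, (1.100) p.34] -/
theorem phiModel_eq (ha : 0 ≤ a) : (Phi176 n M a - 1) * Phi176Inv n M a = 1 - Phi176Inv n M a := by
  rw [Matrix.sub_mul, Matrix.one_mul, Phi176_mul_Phi176Inv n M a ha]

/-- `(φ − 1)φ⁻¹` IS the multiplier `1 − φ_μ(p′)⁻¹` ((1.101): «The operator a⁻¹(φ − 1)/φ has the momentum representation …»).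
[cite: Balaban1984PropagatorsI, (1.101) p.34] -/
theorem phiModel_eq_cMul (ha : 0 ≤ a) :
    (Phi176 n M a - 1) * Phi176Inv n M a = cMul M (fun μ q => 1 - (((phi184 n M a μ q : ℝ) : ℂ))⁻¹) := by
  rw [phiModel_eq n M a ha, ← cMul_one M, Phi176Inv, cMul_sub]
  rfl

/-- the lower model `(φ − 1)φ⁻¹ + P₀` IS the multiplier `1 − φ_μ(p′)⁻¹ + 1_{p′ = 0}`. [cite: Balaban1984PropagatorsI, (1.101) p.34] -/
theorem lowerModel_eq_cMul (ha : 0 ≤ a) :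
    (Phi176 n M a - 1) * Phi176Inv n M a + P0M M
      = cMul M (fun μ q => 1 - (((phi184 n M a μ q : ℝ) : ℂ))⁻¹ + if q = 0 then (1 : ℂ) else 0) := by
  rw [phiModel_eq_cMul n M a ha, P0M_eq_cMul, cMul_add]
  rfl

/-- the symbol `φ_μ(p′)` of (1.84) at a coarse class IS the typed (1.84) `phiMu` of Prop. 1.1 (`= 1 + a·φ^{(1.62)}`).
[cite: Balaban1984PropagatorsI, (1.84) p.31] -/
theorem phi184_eq_phiMu (μ : Fin d) (q : Tor M) : phi184 n M a μ q = B5Prop11Leaves.phiMu n a μ (sOf M q) := by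
  rw [phiMu_eq_one_add n (Nat.one_le_iff_ne_zero.mpr (NeZero.ne n)) a μ (sOf M q) (abs_sOf_le M q)]
  rfl

/-- at a non-zero coarse momentum the symbol of `a⁻¹(φ − 1)φ⁻¹` is (1.101)'s `m_μ(p′)`. [cite: Balaban1984PropagatorsI, (1.101) p.34] -/
theorem symbol_eq_m101 (ha : 0 < a) (μ : Fin d) (q : Tor M) :
    a⁻¹ * (1 - (phi184 n M a μ q)⁻¹) = m101 n a μ (sOf M q) := by
  have hφ : phi184 n M a μ q ≠ 0 := (phi184_pos n M a ha.le μ q).ne'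
  rw [m101, ← phi184_eq_phiMu]
  field_simp

omit [NeZero n] hM in
/-- `φ_μ(p′) ≥ 1`, so `0 ≤ 1 − φ_μ(p′)⁻¹ ≤ 1` (for `a ≥ 0`). [cite: Balaban1984PropagatorsI, p.30 after (1.76)] -/
theorem one_sub_inv_phi184_mem (ha : 0 ≤ a) (μ : Fin d) (q : Tor M) :
    0 ≤ 1 - (phi184 n M a μ q)⁻¹ ∧ 1 - (phi184 n M a μ q)⁻¹ ≤ 1 := by
  have h1 : 1 ≤ phi184 n M a μ q := by
    unfold phi184
    nlinarith [mul_nonneg ha (phi162_nonneg n μ (sOf M q))]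
  have hpos : 0 < phi184 n M a μ q := lt_of_lt_of_le one_pos h1
  constructor
  · rw [sub_nonneg]
    exact inv_le_one_of_one_le₀ h1
  · linarith [inv_nonneg.mpr hpos.le]

omit [NeZero n] hM in
/-- `γ_E = γ₀/(4d + a) ≤ a⁻¹` (`γ₀ ≤ 1`). [folklore] -/
private theorem gammaE_le_inv (ha : 0 < a) : gam0 d / (4 * d + a) ≤ a⁻¹ := by
  have hγ1 := gam0_le_one d
  have hd : (0 : ℝ) ≤ 4 * d := by positivity
  rw [div_le_iff₀ (by linarith), ← div_eq_inv_mul] at *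
  · rw [le_div_iff₀ ha]
    nlinarith [gam0_pos d]

/-- **THE SYMBOL OF THE LOWER MODEL IS BOUNDED BELOW UNIFORMLY**: `γ₀/(4d + a) ≤ a⁻¹(1 − φ_μ(p′)⁻¹ + 1_{p′ = 0})` for EVERY coarse
momentum — at `p′ ≠ 0` this is (1.101) («bounded from below … by positive constants dependent on d only», `B5QGQ199Rate.m101_bounds`),
at `p′ = 0` the constant mode gives `≥ a⁻¹`. [cite: Balaban1984PropagatorsI, (1.101) p.34] -/
theorem symbol_lower (ha : 0 < a) (μ : Fin d) (q : Tor M) :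
    gam0 d / (4 * d + a) ≤ a⁻¹ * (1 - (phi184 n M a μ q)⁻¹ + if q = 0 then (1 : ℝ) else 0) := by
  by_cases hq : q = 0
  · rw [if_pos hq]
    have h0 := (one_sub_inv_phi184_mem n M a ha.le μ q).1
    calc gam0 d / (4 * d + a) ≤ a⁻¹ := gammaE_le_inv a ha
      _ ≤ a⁻¹ * (1 - (phi184 n M a μ q)⁻¹ + 1) := by
          have : (1 : ℝ) ≤ 1 - (phi184 n M a μ q)⁻¹ + 1 := by linarith
          exact le_mul_of_one_le_right (inv_nonneg.mpr ha.le) this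
  · rw [if_neg hq, add_zero, symbol_eq_m101 n M a ha μ q]
    obtain ⟨ν₀, hν₀⟩ := Function.ne_iff.mp (sOf_ne_zero M hq)
    exact (m101_bounds (n := n) (Nat.one_le_iff_ne_zero.mpr (NeZero.ne n)) a ha μ (sOf M q) (abs_sOf_le M q) ν₀ hν₀).1

/-- **`γ_E·I ≤ a⁻¹((φ − 1)φ⁻¹ + P₀)`** in the Löwner order (multiplier with symbol `≥ 0` by `symbol_lower`).
[cite: Balaban1984PropagatorsI, (1.101) p.34] -/
theorem lowerModel_sub_smul_posSemidef (ha : 0 < a) :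
    ((a : ℂ)⁻¹ • ((Phi176 n M a - 1) * Phi176Inv n M a + P0M M)
      - (((gam0 d / (4 * d + a) : ℝ) : ℂ)) • (1 : Matrix (Tor M × Fin d) (Tor M × Fin d) ℂ)).PosSemidef := by
  rw [lowerModel_eq_cMul n M a ha.le, cMul_smul, ← cMul_one M, cMul_smul, cMul_sub]
  refine cMul_posSemidef M fun μ q => ?_
  have h := symbol_lower n M a ha μ q
  simp only [Pi.sub_apply, Pi.smul_apply, smul_eq_mul, mul_one]
  have e : (a : ℂ)⁻¹ * (1 - (((phi184 n M a μ q : ℝ) : ℂ))⁻¹ + if q = 0 then (1 : ℂ) else 0)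
      - (((gam0 d / (4 * d + a) : ℝ) : ℂ))
      = ((a⁻¹ * (1 - (phi184 n M a μ q)⁻¹ + if q = 0 then (1 : ℝ) else 0) - gam0 d / (4 * d + a) : ℝ) : ℂ) := by
    split_ifs <;> push_cast <;> ring
  rw [e]
  exact Complex.zero_le_real.mpr (sub_nonneg.mpr h)

/-- (1.101) for the operator `a⁻¹(φ − 1)/φ` itself, lower half of «bounded from below and above»: `0 ≤ a⁻¹(φ − 1)φ⁻¹` on ALL of `ℓ²`
(the constant mode is in its kernel). [cite: Balaban1984PropagatorsI, (1.101) p.34] -/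
theorem phiModel_posSemidef (ha : 0 < a) : ((a : ℂ)⁻¹ • ((Phi176 n M a - 1) * Phi176Inv n M a)).PosSemidef := by
  rw [phiModel_eq_cMul n M a ha.le, cMul_smul]
  refine cMul_posSemidef M fun μ q => ?_
  have h := (one_sub_inv_phi184_mem n M a ha.le μ q).1
  simp only [Pi.smul_apply, smul_eq_mul]
  rw [← Complex.ofReal_inv, ← Complex.ofReal_one, ← Complex.ofReal_inv, ← Complex.ofReal_sub, ← Complex.ofReal_mul]
  exact Complex.zero_le_real.mpr (mul_nonneg (inv_nonneg.mpr ha.le) h)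

/-- (1.101) for the operator `a⁻¹(φ − 1)/φ` itself, upper half: `a⁻¹(φ − 1)φ⁻¹ ≤ a⁻¹I`. [cite: Balaban1984PropagatorsI, (1.101) p.34] -/
theorem smul_one_sub_phiModel_posSemidef (ha : 0 < a) :
    ((a : ℂ)⁻¹ • (1 : Matrix (Tor M × Fin d) (Tor M × Fin d) ℂ) - (a : ℂ)⁻¹ • ((Phi176 n M a - 1) * Phi176Inv n M a)).PosSemidef := by
  rw [phiModel_eq_cMul n M a ha.le, cMul_smul, ← cMul_one M, cMul_smul, cMul_sub]
  refine cMul_posSemidef M fun μ q => ?_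
  have h := (one_sub_inv_phi184_mem n M a ha.le μ q).2
  simp only [Pi.sub_apply, Pi.smul_apply, smul_eq_mul, mul_one]
  rw [← Complex.ofReal_inv, ← Complex.ofReal_one, ← Complex.ofReal_inv, ← Complex.ofReal_sub, ← Complex.ofReal_mul,
    ← Complex.ofReal_sub]
  refine Complex.zero_le_real.mpr (sub_nonneg.mpr ?_)
  exact mul_le_of_le_one_right (inv_nonneg.mpr ha.le) h

/-- (1.101) lower bound for `a⁻¹(φ − 1)/φ` on the ORTHOGONAL COMPLEMENT OF THE CONSTANTS (the subspace where Sect. E places `φ`,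
p. 30): `γ_E‖ω‖² ≤ Re⟨ω, a⁻¹(φ − 1)φ⁻¹ω⟩` for `ω ⊥` constants. [cite: Balaban1984PropagatorsI, (1.101) p.34] -/
theorem re_form_phiModel_ge_of_orthConst (ha : 0 < a) (ω : Tor M × Fin d → ℂ) (hω : OrthConst M ω) :
    gam0 d / (4 * d + a) * (star ω ⬝ᵥ ω).re
      ≤ (star ω ⬝ᵥ (((a : ℂ)⁻¹ • ((Phi176 n M a - 1) * Phi176Inv n M a)) *ᵥ ω)).re := by
  -- `P₀ω = 0`, so the lower model and `a⁻¹(φ − 1)φ⁻¹` have the same form at `ω`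
  have hP : P0M M *ᵥ ω = 0 := by
    rw [P0M_mulVec]
    funext ⟨y, μ⟩
    simp only [B0, constV, Pi.zero_apply, hω μ, mul_zero]
  have h := (lowerModel_sub_smul_posSemidef n M a ha).dotProduct_mulVec_nonneg ω
  rw [Matrix.sub_mulVec, Matrix.smul_mulVec, Matrix.add_mulVec, hP, add_zero, ← Matrix.smul_mulVec,
    Matrix.smul_mulVec (((gam0 d / (4 * d + a) : ℝ) : ℂ)), Matrix.one_mulVec, dotProduct_sub, dotProduct_smul,
    smul_eq_mul] at h
  have h' := (Complex.nonneg_iff.mp h).1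
  rw [Complex.sub_re, Complex.re_ofReal_mul] at h'
  linarith

end Model

/-! ## §3  «The same property holds for QGQ*»: `γ_E·I ≤ QGQ* ≤ a⁻¹I` uniformly in `n = L^k` and in the torus -/

section QGQ

variable (n : ℕ) [NeZero n] (M : Fin d → ℕ) [hM : ∀ μ, NeZero (M μ)] (a : ℝ)

/-- (1.99) rearranged: `QGQ* = a⁻¹((φ − 1)φ⁻¹ + P₀) + a⁻¹·(∂₁*φ⁻¹)ᴴ(∂₁*φ⁻¹∂₁)⁻¹(∂₁*φ⁻¹)` (from `B5Eq199QGQTorus.QGQ_sub_lower_eq`).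
[cite: Balaban1984PropagatorsI, (1.99) p.34] -/
theorem QGQ_eq_lowerModel_add_gram (ha : 0 < a) :
    QvOp n M * (DeltaA n M a)⁻¹ * QvAdj n M
      = (a : ℂ)⁻¹ • ((Phi176 n M a - 1) * Phi176Inv n M a + P0M M)
        + (a : ℂ)⁻¹ • (((GradOp M 1)ᴴ * Phi176Inv n M a)ᴴ * GPhiEInv n M a * ((GradOp M 1)ᴴ * Phi176Inv n M a)) := by
  have h := QGQ_sub_lower_eq n M a ha
  rw [sub_eq_iff_eq_add] at h
  rw [h, smul_add, smul_add]
  abel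

/-- **p. 34: «The same property holds for QGQ*» — THE UNIFORM LOWER BOUND**: `QGQ* − γ_E·I ⪰ 0` on `ℓ²(T₁^{(k)}; ℂ^d)` with
`γ_E = γ₀/(4d + a)`, `γ₀ = (4/π²)^{d+2}`, for EVERY `n = L^k ≥ 1`, EVERY torus `T₁^{(k)} = Tor M` and every `a > 0` (for `a = 1`: a constant
depending on `d` only).  Proof = the printed one: (1.100) lower half + (1.101) per fibre + the constant mode (`QGQ*c = a⁻¹c`).
[cite: Balaban1984PropagatorsI, (1.101) p.34] -/
theorem QGQ_sub_smul_one_posSemidef (ha : 0 < a) :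
    (QvOp n M * (DeltaA n M a)⁻¹ * QvAdj n M
      - (((gam0 d / (4 * d + a) : ℝ) : ℂ)) • (1 : Matrix (Tor M × Fin d) (Tor M × Fin d) ℂ)).PosSemidef := by
  rw [QGQ_eq_lowerModel_add_gram n M a ha, add_sub_right_comm]
  refine (lowerModel_sub_smul_posSemidef n M a ha).add ?_
  rw [← Complex.ofReal_inv]
  exact ((GPhiEInv_posSemidef n M a ha.le).conjTranspose_mul_mul_same _).smul
    (Complex.zero_le_real.mpr (inv_nonneg.mpr ha.le))

/-- **(1.100)–(1.101) for `QGQ*`, both halves**: `γ_E·I ≤ QGQ* ≤ a⁻¹I` in the Löwner order, uniformly in `n` and in the torus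
(upper half = `B5Eq199QGQTorus.ineq1100_upper`). [cite: Balaban1984PropagatorsI, (1.100) p.34] -/
theorem QGQ_twoSided (ha : 0 < a) :
    (QvOp n M * (DeltaA n M a)⁻¹ * QvAdj n M
        - (((gam0 d / (4 * d + a) : ℝ) : ℂ)) • (1 : Matrix (Tor M × Fin d) (Tor M × Fin d) ℂ)).PosSemidef
      ∧ ((a : ℂ)⁻¹ • (1 : Matrix (Tor M × Fin d) (Tor M × Fin d) ℂ)
        - QvOp n M * (DeltaA n M a)⁻¹ * QvAdj n M).PosSemidef :=
  ⟨QGQ_sub_smul_one_posSemidef n M a ha, ineq1100_upper n M a ha⟩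

/-- the quadratic-form reading: **`γ_E·‖ω‖² ≤ Re⟨ω, QGQ*ω⟩`** for every `ω` (unit-lattice scalar product (1.21) = the plain sum).
[cite: Balaban1984PropagatorsI, (1.101) p.34] -/
theorem re_form_QGQ_ge (ha : 0 < a) (ω : Tor M × Fin d → ℂ) :
    gam0 d / (4 * d + a) * (star ω ⬝ᵥ ω).re
      ≤ (star ω ⬝ᵥ ((QvOp n M * (DeltaA n M a)⁻¹ * QvAdj n M) *ᵥ ω)).re := by
  have h := (Complex.nonneg_iff.mp ((QGQ_sub_smul_one_posSemidef n M a ha).dotProduct_mulVec_nonneg ω)).1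
  rw [Matrix.sub_mulVec, dotProduct_sub, Complex.sub_re, Matrix.smul_mulVec, Matrix.one_mulVec, dotProduct_smul,
    smul_eq_mul, Complex.re_ofReal_mul] at h
  linarith

/-- **both halves as quadratic forms**: `γ_E·‖ω‖² ≤ Re⟨ω, QGQ*ω⟩ ≤ a⁻¹‖ω‖²`. [cite: Balaban1984PropagatorsI, (1.100) p.34] -/
theorem re_form_QGQ_bounds (ha : 0 < a) (ω : Tor M × Fin d → ℂ) :
    gam0 d / (4 * d + a) * (star ω ⬝ᵥ ω).re
        ≤ (star ω ⬝ᵥ ((QvOp n M * (DeltaA n M a)⁻¹ * QvAdj n M) *ᵥ ω)).re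
      ∧ (star ω ⬝ᵥ ((QvOp n M * (DeltaA n M a)⁻¹ * QvAdj n M) *ᵥ ω)).re ≤ a⁻¹ * (star ω ⬝ᵥ ω).re :=
  ⟨re_form_QGQ_ge n M a ha ω, (B5Eq199QGQTorus.ineq1100_form n M a ha ω).2⟩

/-- the same lower bound for `B5QGQ171Unit.covB = Q𝒢Q*` (`= Q(Δ_a)⁻¹Q*`, `B5Eq199QGQTorus.QGQ_eq_covB`): `covB − γ_E·I ⪰ 0`.
[cite: Balaban1984PropagatorsI, (1.101) p.34] -/
theorem covB_sub_smul_one_posSemidef (hn : 1 ≤ n) (ha : 0 < a) :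
    (covB n hn M a ha - (((gam0 d / (4 * d + a) : ℝ) : ℂ)) • (1 : Matrix (Tor M × Fin d) (Tor M × Fin d) ℂ)).PosSemidef := by
  rw [← QGQ_eq_covB n M a hn ha]
  exact QGQ_sub_smul_one_posSemidef n M a ha

/-- positivity of the constant («positive constants dependent on d only»): `0 < γ_E = γ₀/(4d + a)`. [cite: Balaban1984PropagatorsI, (1.101) p.34] -/
theorem gammaE_pos (ha : 0 < a) : 0 < gam0 d / (4 * d + a) := by
  have := gam0_pos d
  positivity

end QGQ

end

end Literature.MathematicalPhysics.QuantumFieldTheory.Balaban1983to89.B5Ineq1101QGQTorus
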